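import Mathlib
import HarnessLib
import Summits.CriticalPhenomena.CardyFormulaZ2.Theses.CardyMagicRigidity
import Summits.CriticalPhenomena.CardyFormulaZ2.Theorems.CardyMagicRigidityMagicFormulaTSmearedCentring
import Literature.Probability.RandomPlanarGeometry.NestingTransform

/-!
# Line `analytic-coupling` for crux `MagicFormulaT` (stmt-CriticalPhenomena-4836) — strategist s3, ALTERNATIVE line

Crux (fixed): `Summit.CriticalPhenomena.CardyFormulaZ2.Theses.CardyMagicRigidity.MagicFormulaT` — for every
admissible density `f` (measurable, `|f| ≤ C`, `f = 0` off `‖z‖ ≤ R`, `∫ f = 0`) the site-`𝕋` twisted nesting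
transform `Λ^𝕋_δ(f) = E_{1/2}[∏_u 2cos(θ_u(f) + π/3)]`, `θ_u(f) = ∫_{W(u,·)≠0} f`, tends to
`G(f) = exp((3/4π²) ∬ log‖x−y‖ f(x) f(y))` as `δ → 0⁺`.

## Idea (lever): analyticity in the COUPLING CONSTANT + coefficientwise identification

Replace `f` by `t·f` and let `t` be COMPLEX.  At every mesh `δ > 0` the map
`Φ_δ(t) := E[∏_u 2cos(t·θ_u(f) + π/3)]` is an ENTIRE function of `t` (finitely many loops meet `B̄_R`,
Disproof F3) whose restriction to real `t` is `Λ^𝕋_δ(t f)`; its value at `t = 1` is the crux's expectation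
and its Taylor coefficients at `t = 0` are the finite-order NESTING MOMENT FUNCTIONALS
`Φ_δ^{(k)}(0) = E[Σ_{(m_u), Σ m = k} k!/∏m_u! ∏_u w^{(m_u)}(π/3) θ_u^{m_u}]` — polynomials in the power sums
`A_m = Σ_u θ_u^m = ∫ f^{⊗m} N_δ(x₁ ∧ … ∧ x_m)`, i.e. integrals of `f^{⊗k}` against joint moments of the nested
alternating-CIRCUIT counts around finite point sets (events of the quad-crossing σ-field: no loop matching,
no `d_CN` coupling, no ribbon rarity).  The line is:

* `stub_entire` (E, provable now from landed material): `(Φ_δ)_{δ→0⁺}` is a NORMAL FAMILY — uniformly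
  bounded on every closed ball `‖t‖ ≤ ρ`, eventually in `δ` — with `Φ_δ(0) = 1`, `Φ_δ|_ℝ = Λ^𝕋_δ(t f)` and
  `Φ_δ'(0) = −√3·E[Σ_u θ_u]`.  Proof plan: the landed UV machine of line `Sketch` v6 run for complex `t`
  (`|1+g| ≤ exp(Re g + |g|²/2)` for the small loops, so the band exponential moments `stub_bandExpMoment`
  (p138445) with the EXACT centring `stub_bandCentring` (p139348) / `smearedCentring` (p105356) and the
  first-moment bound `stub_bandFirstMoment` (p138361) control `E|∏_{diam<r₀} w(tθ_u)|^3`, while the keystone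
  all-order exponential moments of the number of loops of diameter `≥ r₀(ρ, C)` meeting `B̄_R`
  (`expMoment_ncard_bigLoops_meeting_le_ball`, crux 4835) control `(2cosh(ρ C π R²))^{N_big}`; Hölder).
  Differentiability under the integral by domination at fixed mesh.
* `stub_taylorLimit` (provable now, pure complex analysis, M): a normal family of entire functions whose
  Taylor coefficients at `0` converge to those of an entire `G` converges to `G` pointwise (Cauchy estimates
  on `‖t‖ = 2ρ`, uniform tails, finitely many coefficients).
* the landed EXACT CENTRING (`smearedCentring`, p105356) is the order-1 input VERBATIM (used in the glue).
* `stub_coeffLimits` (X, provable, L–XL, inputs published): every Taylor coefficient `Φ_δ^{(k)}(0)` — a fixed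
  polynomial in the power sums `A_m = Σ_u θ_u^m = ∫ f^{⊗m} N_δ(x₁∧…∧x_m)` — has a limit as `δ → 0⁺`: joint moments of
  NESTED LOOP COUNTS around finite point sets converge (template: Yao, arXiv:1602.00065 Prop. 3.1: Camia–Newman coupling +
  "two nested discrete loops do not merge" by the polychromatic six-arm bound `α₆ > 2` + exponential tails), then dominated
  convergence in the point variables (uniform RSW bound `E N_δ(x∧y) ≤ K log(R/‖x−y‖) + K`) and the landed UV machine.
* `stub_secondOrder` (order 2 = SSW level, provable): the limit of the second coefficient `3E[A₁²] − 4E[A₂]` is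
  `(3/2π²) Q(f)` — the two-point form of Yao's Thm 1.1 / Prop. 3.2 (`ν = 1/(2√3π)`, `ν₂ = 2/(3√3π) − 1/(2π²)` from
  Schramm–Sheffield–Wilson's law of CLE₆ conformal-radius decrements); neutrality kills the `O(1)` constants and
  `2ν − (3/2)ν₂ = 3/(4π²)` EXACTLY (checked by ideators 1, 2 and lead gen 1; it is the `λ²`-order of SSW's two-point
  exponent `Δ₆(λ)+Δ₆(−λ) = 3λ²/2π²`).
* `stub_thirdOrder` (FIRST OPEN ORDER = Disproof F5's evenness, the route's sharpest falsifiable prediction): the limit of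
  the third coefficient is `0` (on `ℤ²` it vanishes at every mesh by `h ↦ −h`; on `𝕋` it is the connected 3-point
  twisted-nesting cumulant of full-plane CLE₆ = the sphere 4-point nesting function, no formula in print; MC:
  `|c₃| ≤ 1 %·c₂`, ideator 2).
* `stub_higherOrders` (open core, graded): the limit of every coefficient of order `≥ 4` is the Gaussian's.

Composition `MagicFormulaT_of`: E + centring (orders 0, 1) + X with the identifications at orders 2, 3, ≥ 4 give
coefficientwise convergence
`Φ_δ^{(k)}(0) → G^{(k)}(0)` for every `k` (`G(t) = exp(q(f) t²)` entire); `stub_taylorLimit` gives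
`Φ_δ(1) → G(1)`; real parts give the crux.  EXISTENCE of the scaling limit of `Λ^𝕋_δ(t f)` (lead c3's v7
stub (E)) is a COROLLARY here (E + X + normality), not a prerequisite, and no continuum loop-ensemble object appears in
any stub.

Why it dodges the STUCK goal of line `Sketch` (v6 `stub_bigLoopsMagicT` = truncated crux; v7 = existence via
`d_CN` coupling + ribbon rarity, then identification-given-existence): this line never takes the limit of a
PRODUCT functional along a coupling; lattice → continuum enters only through limits of probabilities of
finitely many nested alternating monochromatic CIRCUIT events around finite point sets (order `k` needs
`k`-point count statistics), which are quad-crossing events with RSW tails; the open content is GRADED by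
order and order 3 is separately killable.

Disproof.lean v4 (Cruxes/MagicFormulaT/Disproof.lean) honoured: F3 (finite product at `δ > 0`) is what makes
`Φ_δ` entire; F5 (evenness necessary) IS `stub_thirdOrder`; F8 (`not_magicFormulaTEveryMesh`): no fixed-mesh
identity with the Gaussian is claimed — `stub_entire` asserts only analyticity/bounds at fixed mesh, every
identification is a `δ → 0⁺` limit; F9/F4 (resists as universality): untouched — orders ≥ 3 carry it; F10
(Beffara): the isotropic exact input enters through the VALUES in `stub_secondOrder`/`thirdOrder`/`higherOrders`
(CLE₆ on the equilateral embedding); `_false_without_`: none exists; `-- Targets`: none.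
-/

noncomputable section

namespace Summit.CriticalPhenomena.CardyFormulaZ2.Cruxes.MagicFormulaT.AnalyticCoupling

open MeasureTheory Filter Set Metric Complex
open scoped Topology Real
open Literature.Probability.RandomPlanarGeometry Literature.Probability.Percolation
  Literature.Probability.LatticeModels
open Summit.CriticalPhenomena.CardyFormulaZ2.Theses.CardyMagicRigidity

/-! ## Vocabulary (abbreviations of the crux's own expressions; no new mathematics) -/

/-- The index set of the crux's `finprod`: the honeycomb interface loops of `cfg` at mesh `δ` as unbased
loops (`= (siteLoopConfig δ cfg).loops`, `Theorems.loops_siteLoopConfig`). -/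
def tLoops (δ : ℝ) (cfg : SiteConfig (Site 2)) : Set (UnbasedLoop ℂ) :=
  {u : UnbasedLoop ℂ | ∃ (v : HexVertex) (γ : hexGraph.Walk v v), IsSiteInterfaceLoop cfg γ ∧
    u = UnbasedLoop.mk (BasedLoop.mk (siteLoopCurve δ γ) (isLoop_siteLoopCurve δ γ))}

/-- The site-`𝕋` twisted nesting transform `Λ^𝕋_δ(f)` of the crux, literally. -/
def tNesting (f : ℂ → ℝ) (δ : ℝ) : ℝ :=
  ∫ cfg, (∏ᶠ u ∈ tLoops δ cfg, 2 * Real.cos ((∫ z in {z : ℂ | u.wind z ≠ 0}, f z) + Real.pi / 3))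
    ∂(triSitePercolation half)

/-- The Gaussian functional `G(f) = exp((3/4π²) ∬ log‖x−y‖ f(x) f(y))` of the crux, literally. -/
def tGaussian (f : ℂ → ℝ) : ℝ :=
  Real.exp (3 / (4 * Real.pi ^ 2) * ∫ x, ∫ y, Real.log ‖x - y‖ * f x * f y)

/-- The crux unfolded (definitional). -/
theorem magicFormulaT_iff :
    MagicFormulaT ↔ ∀ (f : ℂ → ℝ) (R C : ℝ), Measurable f → (∀ z, |f z| ≤ C) →
      (∀ z, R < ‖z‖ → f z = 0) → ∫ z, f z = 0 → Tendsto (tNesting f) (𝓝[>] 0) (𝓝 (tGaussian f)) :=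
  Iff.rfl

/-- **The complex-coupling transform** `Φ_δ(t) = E_{1/2}[∏_u 2cos(t·θ_u(f) + π/3)]`, `t ∈ ℂ`,
`θ_u(f) = ∫_{W(u,·)≠0} f`: at real `t` it is `Λ^𝕋_δ(t f)`; at `t = 1` the crux's expectation. -/
def cNesting (f : ℂ → ℝ) (δ : ℝ) (t : ℂ) : ℂ :=
  ∫ cfg, (∏ᶠ u ∈ tLoops δ cfg,
    (2 * Complex.cos (t * ((∫ z in {z : ℂ | u.wind z ≠ 0}, f z : ℝ) : ℂ) + (Real.pi : ℂ) / 3)))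
      ∂(triSitePercolation half)

/-- The logarithmic energy coefficient `q(f) = (3/4π²) ∬ log‖x−y‖ f(x) f(y)`. -/
def logCoeff (f : ℂ → ℝ) : ℝ := 3 / (4 * Real.pi ^ 2) * ∫ x, ∫ y, Real.log ‖x - y‖ * f x * f y

/-- **The Gaussian as an entire function of the coupling**: `G_f(t) = exp(q(f) t²)`. -/
def cGaussian (f : ℂ → ℝ) (t : ℂ) : ℂ := Complex.exp ((logCoeff f : ℂ) * t ^ 2)

/-! ## Stubs -/

/-- **Stub E (`stub_entire`) · the transforms are a NORMAL FAMILY of entire functions of the coupling.**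
For every admissible `f`: (a) at every mesh `δ > 0`, `Φ_δ = cNesting f δ` is entire; (b) at real `t` it is
the crux's transform of `t·f`; (c) for every radius `ρ` there is `M` with `‖Φ_δ(t)‖ ≤ M` on `‖t‖ ≤ ρ` for all
small meshes; (d) `Φ_δ(0) = 1` and `Φ_δ'(0) = −√3 · E[Σ_u θ_u(f)]` (the first nesting moment).
Provable now: (c) is the landed UV machine run for complex coupling (small loops: `|1+g| ≤ e^{Re g + |g|²/2}`,
band exponential moments + exact centring + keystone exponential moments of `N_big`; Hölder); (a), (d):
differentiation under the integral, dominated at fixed mesh by `(2cosh(ρ‖θ‖_∞))^{N_max(δ,R)}`. -/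
theorem stub_entire : ∀ (f : ℂ → ℝ) (R C : ℝ), Measurable f → (∀ z, |f z| ≤ C) →
    (∀ z, R < ‖z‖ → f z = 0) → ∫ z, f z = 0 →
    (∀ δ : ℝ, 0 < δ → Differentiable ℂ (cNesting f δ)) ∧
    (∀ δ : ℝ, 0 < δ → ∀ t : ℝ, cNesting f δ (t : ℂ) = ((tNesting (fun z ↦ t * f z) δ : ℝ) : ℂ)) ∧
    (∀ ρ : ℝ, 0 < ρ → ∃ M : ℝ, ∀ᶠ δ in 𝓝[>] (0 : ℝ), ∀ t : ℂ, ‖t‖ ≤ ρ → ‖cNesting f δ t‖ ≤ M) ∧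
    (∀ δ : ℝ, 0 < δ → cNesting f δ 0 = 1 ∧
      deriv (cNesting f δ) 0 = -((Real.sqrt 3 : ℝ) : ℂ) *
        ((∫ ω, (∑ᶠ u ∈ (siteLoopConfig δ ω).loops, ∫ z in {z : ℂ | u.wind z ≠ 0}, f z)
          ∂(triSitePercolation half) : ℝ) : ℂ)) := by
  sorry

/-- **Stub T (`stub_taylorLimit`) · coefficientwise convergence of a normal family of entire functions.**
If `F_δ` is entire for all small `δ`, uniformly bounded on each closed ball eventually in `δ`, and every
Taylor coefficient at `0` converges to that of an entire `G`, then `F_δ(t) → G(t)` for every `t ∈ ℂ`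
(Cauchy estimates on `‖t‖ = 2ρ` bound the tails uniformly; finitely many coefficients converge; `G`'s Taylor
series converges to `G`).  Pure Mathlib complex analysis, provable now. -/
theorem stub_taylorLimit : ∀ (F : ℝ → ℂ → ℂ) (G : ℂ → ℂ),
    (∀ᶠ δ in 𝓝[>] (0 : ℝ), Differentiable ℂ (F δ)) → Differentiable ℂ G →
    (∀ ρ : ℝ, 0 < ρ → ∃ M : ℝ, ∀ᶠ δ in 𝓝[>] (0 : ℝ), ∀ t : ℂ, ‖t‖ ≤ ρ → ‖F δ t‖ ≤ M) →
    (∀ k : ℕ, Tendsto (fun δ ↦ iteratedDeriv k (F δ) 0) (𝓝[>] (0 : ℝ)) (𝓝 (iteratedDeriv k G 0))) →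
    ∀ t : ℂ, Tendsto (fun δ ↦ F δ t) (𝓝[>] (0 : ℝ)) (𝓝 (G t)) := by
  sorry

/-- **Stub X (`stub_coeffLimits`) · every Taylor coefficient of the transform has a scaling limit.**  For every
admissible `f` and every order `k`, `Φ_δ^{(k)}(0)` converges as `δ → 0⁺`.  `Φ_δ^{(k)}(0)` is a fixed polynomial in the
power sums `A_m = Σ_u θ_u(f)^m = ∫ f^{⊗m} N_δ(x₁ ∧ … ∧ x_m)` (`N_δ(S)` = number of interface loops surrounding the finite
set `S` and not all of `supp f`), so this is the convergence of the joint moments of NESTED LOOP COUNTS around finite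
point sets, integrated against `f^{⊗k}`: the template is Yao, arXiv:1602.00065, Prop. 3.1 (counts of cluster-boundary
loops surrounding a point in a macroscopic annulus converge in law with all moments to the CLE₆ counts: Camia–Newman
full scaling limit + "two nested discrete loops do not merge" by the polychromatic SIX-arm bound `α₆ > 2` + exponential
tails, his Lemma 2.5), run jointly for finitely many point sets, plus dominated convergence in the point variables
(uniform RSW bound `E N_δ(x ∧ y) ≤ K log(R/‖x−y‖) + K`, `log` locally integrable) and the UV control of the landed
machine.  Provable (L–XL), inputs published. -/
theorem stub_coeffLimits : ∀ (f : ℂ → ℝ) (R C : ℝ), Measurable f → (∀ z, |f z| ≤ C) →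
    (∀ z, R < ‖z‖ → f z = 0) → ∫ z, f z = 0 → ∀ k : ℕ, ∃ a : ℂ,
    Tendsto (fun δ ↦ iteratedDeriv k (cNesting f δ) 0) (𝓝[>] (0 : ℝ)) (𝓝 a) := by
  sorry

/-- **Stub 2 (`stub_secondOrder`) · the quadratic coefficient is the logarithmic energy (SSW level; provable).**
For every admissible `f`, the limit of the second coefficient `3E[(Σ_u θ_u)²] − 4E[Σ_u θ_u²]` is
`(3/2π²) ∬ log‖x−y‖ f f` (the second coefficient of `G_f`): with `E N(x∧y) = ν log(1/‖x−y‖) + C₁ + o(1)` and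
`Cov(N(x), N(y)) = ν₂ log(1/‖x−y‖) + C₂ + o(1)` (two-point form of Yao's Prop. 3.2 / Thm 1.1, arXiv:1602.00065:
`ν = 1/(2√3π)`, `ν₂ = 2/(3√3π) − 1/(2π²)`, from the Schramm–Sheffield–Wilson law `E e^{λB} = 1/(2cos(π√(1/9+4λ/3)))`
of the CLE₆ log-conformal-radius decrements), neutrality `∫ f = 0` kills the constants and `2ν − (3/2)ν₂ = 3/(4π²)`
EXACTLY gives the coefficient.  Known mathematics + an L-sized two-point extension; not in the tree. -/
theorem stub_secondOrder : ∀ (f : ℂ → ℝ) (R C : ℝ), Measurable f → (∀ z, |f z| ≤ C) →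
    (∀ z, R < ‖z‖ → f z = 0) → ∫ z, f z = 0 → ∀ a : ℂ,
    Tendsto (fun δ ↦ iteratedDeriv 2 (cNesting f δ) 0) (𝓝[>] (0 : ℝ)) (𝓝 a) →
      a = iteratedDeriv 2 (cGaussian f) 0 := by
  sorry

/-- **Stub 3 (`stub_thirdOrder`) · the cubic coefficient vanishes in the limit (EVENNESS at order 3 = Disproof F5;
the FIRST OPEN ORDER).**  For every admissible `f`, the limit of the third coefficient (a fixed combination of `E[A₃]`,
`E[A₁A₂]`, `E[A₁³]`, i.e. of 3-point nested-count statistics) is the third coefficient of `G_f`, namely `0`: the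
connected three-point twisted-nesting cumulant of full-plane CLE₆ vanishes.  It is `0` identically on `ℤ²` at every mesh
(height reversal, DKLM); on `𝕋` it must EMERGE (Monte-Carlo `|c₃| ≤ 1 %·c₂`, ideator 2; no closed form in print — the
CLE₆ sphere four-point nesting function, lead c1).  Mechanisms on record: anomalous Möbius covariance +
conjugate-identity defect ⇒ `K₃ = 0` (idea identity-charge-decoupling); Kang–Makarov radial martingales through the
CLE₆ renewal (km-renewal / two-channel).  Open. -/
theorem stub_thirdOrder : ∀ (f : ℂ → ℝ) (R C : ℝ), Measurable f → (∀ z, |f z| ≤ C) →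
    (∀ z, R < ‖z‖ → f z = 0) → ∫ z, f z = 0 → ∀ a : ℂ,
    Tendsto (fun δ ↦ iteratedDeriv 3 (cNesting f δ) 0) (𝓝[>] (0 : ℝ)) (𝓝 a) →
      a = iteratedDeriv 3 (cGaussian f) 0 := by
  sorry

/-- **Stub ≥4 (`stub_higherOrders`) · all higher coefficients are Gaussian in the limit (the graded open core:
"bosonisation of CLE₆ is exact", order by order).**  For every admissible `f` and every `k ≥ 4`, the limit of the `k`-th
coefficient is that of `G_f` (odd `k`: `0`; even `k`: the Wick value): vanishing of the connected `k`-point twisted-nesting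
cumulants of full-plane CLE₆ (the `O(1)` mixed cumulants `∫ k_n f^{⊗n}` of TRIAGE r1-2 §D2), in lattice clothing through
`k`-point nested-count statistics.  Open; nothing in print beyond three points (ACSW arXiv:2107.01788). -/
theorem stub_higherOrders : ∀ (f : ℂ → ℝ) (R C : ℝ), Measurable f → (∀ z, |f z| ≤ C) →
    (∀ z, R < ‖z‖ → f z = 0) → ∫ z, f z = 0 → ∀ k : ℕ, 4 ≤ k → ∀ a : ℂ,
    Tendsto (fun δ ↦ iteratedDeriv k (cNesting f δ) 0) (𝓝[>] (0 : ℝ)) (𝓝 a) →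
      a = iteratedDeriv k (cGaussian f) 0 := by
  sorry

/-! ## Glue -/

/-- `G_f` is entire. -/
theorem differentiable_cGaussian (f : ℂ → ℝ) : Differentiable ℂ (cGaussian f) := by
  unfold cGaussian
  fun_prop

/-- `G_f(0) = 1`. -/
theorem cGaussian_zero (f : ℂ → ℝ) : cGaussian f 0 = 1 := by
  simp [cGaussian]

/-- `G_f'(0) = 0`. -/
theorem deriv_cGaussian_zero (f : ℂ → ℝ) : deriv (cGaussian f) 0 = 0 := by
  have h1 : HasDerivAt (fun t : ℂ ↦ (logCoeff f : ℂ) * t ^ 2) ((logCoeff f : ℂ) * (↑(2 : ℕ) * (0 : ℂ) ^ (2 - 1))) 0 :=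
    (hasDerivAt_pow 2 (0 : ℂ)).const_mul _
  have h2 : HasDerivAt (cGaussian f)
      (Complex.exp ((logCoeff f : ℂ) * (0 : ℂ) ^ 2) * ((logCoeff f : ℂ) * (↑(2 : ℕ) * (0 : ℂ) ^ (2 - 1)))) 0 :=
    h1.cexp
  rw [h2.deriv]
  simp

/-- `G_f(1) = G(f)` as a complex number. -/
theorem cGaussian_one (f : ℂ → ℝ) : cGaussian f 1 = ((tGaussian f : ℝ) : ℂ) := by
  simp [cGaussian, tGaussian, logCoeff, Complex.ofReal_exp]

/-- **Exact centring at order 1** (landed `smearedCentring`, p105356): `Φ_δ'(0) = 0` at every mesh. -/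
theorem deriv_cNesting_zero {f : ℂ → ℝ} {R C : ℝ} (hf : Measurable f) (hC : ∀ z, |f z| ≤ C)
    (hR : ∀ z, R < ‖z‖ → f z = 0) (h0 : ∫ z, f z = 0) {δ : ℝ} (hδ : 0 < δ) :
    deriv (cNesting f δ) 0 = 0 := by
  obtain ⟨-, -, -, hd⟩ := stub_entire f R C hf hC hR h0
  rw [(hd δ hδ).2, LineSketch.smearedCentring half f R C δ hf hC hR h0 hδ]
  simp

/-! ## Composition -/

/-- **The line closes the crux modulo its stubs.**  Coefficientwise: order 0 (`Φ_δ(0) = 1`), order 1 (exact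
centring, landed), then `stub_coeffLimits` + the identifications `stub_secondOrder` / `stub_thirdOrder` /
`stub_higherOrders` at orders 2 / 3 / ≥ 4;
then `stub_taylorLimit` on the normal family of `stub_entire`; then real parts at `t = 1`. -/
theorem MagicFormulaT_of :
    Summit.CriticalPhenomena.CardyFormulaZ2.Theses.CardyMagicRigidity.MagicFormulaT := by
  rw [magicFormulaT_iff]
  intro f R C hf hC hR h0
  obtain ⟨hdiff, hreal, hbound, hd⟩ := stub_entire f R C hf hC hR h0
  have hpos : ∀ᶠ δ in 𝓝[>] (0 : ℝ), 0 < δ := self_mem_nhdsWithin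
  -- coefficientwise convergence at every order
  have hk : ∀ k : ℕ, Tendsto (fun δ ↦ iteratedDeriv k (cNesting f δ) 0) (𝓝[>] (0 : ℝ))
      (𝓝 (iteratedDeriv k (cGaussian f) 0)) := by
    intro k
    match k with
    | 0 =>
        simp only [iteratedDeriv_zero, cGaussian_zero]
        refine (tendsto_const_nhds (x := (1 : ℂ))).congr' ?_
        filter_upwards [hpos] with δ hδ
        exact ((hd δ hδ).1).symm
    | 1 =>
        simp only [iteratedDeriv_one, deriv_cGaussian_zero]
        refine (tendsto_const_nhds (x := (0 : ℂ))).congr' ?_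
        filter_upwards [hpos] with δ hδ
        exact (deriv_cNesting_zero hf hC hR h0 hδ).symm
    | 2 =>
        obtain ⟨a, ha⟩ := stub_coeffLimits f R C hf hC hR h0 2
        rwa [stub_secondOrder f R C hf hC hR h0 a ha] at ha
    | 3 =>
        obtain ⟨a, ha⟩ := stub_coeffLimits f R C hf hC hR h0 3
        rwa [stub_thirdOrder f R C hf hC hR h0 a ha] at ha
    | k + 4 =>
        obtain ⟨a, ha⟩ := stub_coeffLimits f R C hf hC hR h0 (k + 4)
        rwa [stub_higherOrders f R C hf hC hR h0 (k + 4) (by omega) a ha] at ha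
  -- the normal family converges to the Gaussian at every coupling, in particular at `t = 1`
  have hdiff' : ∀ᶠ δ in 𝓝[>] (0 : ℝ), Differentiable ℂ (cNesting f δ) := by
    filter_upwards [hpos] with δ hδ using hdiff δ hδ
  have hlim := stub_taylorLimit (cNesting f) (cGaussian f) hdiff' (differentiable_cGaussian f) hbound hk 1
  -- back to the real transform at coupling `1`
  have hlim' : Tendsto (fun δ ↦ ((tNesting f δ : ℝ) : ℂ)) (𝓝[>] (0 : ℝ)) (𝓝 ((tGaussian f : ℝ) : ℂ)) := by
    rw [← cGaussian_one]
    refine hlim.congr' ?_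
    filter_upwards [hpos] with δ hδ
    have := hreal δ hδ 1
    simp only [Complex.ofReal_one, one_mul] at this
    exact this
  have key := (Complex.continuous_re.tendsto _).comp hlim'
  have hre : (Complex.re ∘ fun δ ↦ ((tNesting f δ : ℝ) : ℂ)) = tNesting f := by
    funext δ
    simp
  rw [hre, Complex.ofReal_re] at key
  exact key

end Summit.CriticalPhenomena.CardyFormulaZ2.Cruxes.MagicFormulaT.AnalyticCoupling

end
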